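import Summits.KontsevichZagierPeriods.KontsevichZagierPeriods.Theorems.StuffleInKZ.Negative.Core
import Literature.NumberTheory.Transcendental.MultipleZetaProofs

/-!
# `StuffleInKZ` (stmt-KontsevichZagierPeriods-3931): negative side — load-bearing hypotheses and
# refuted strengthenings

Companion of `Negative/Core.lean` (cdisprove unit of the crux `StuffleInKZ`, route
`FurushoPentagon`). PROVED here:

* §1 every hypothesis of the crux is load-bearing ("any proof must use it"):
  `stuffleInKZ_false_without_pinning` (an unpinned assignment, `Z ≡ [pt,1]`, breaks it at
  `s = t = [2]`), `stuffleInKZ_false_without_admissibleRight` (`s = [2]`, `t = [1]`: the stuffle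
  term `[1,2]` is not admissible, so `Z [1,2]` is unconstrained — two pinned assignments differing
  there by `[pt,1]` cannot both work; no real-number input), `…_without_admissibleLeft`;
* §2 refuted natural strengthenings: the stuffle is not an identity of formal combinations
  (`not_stuffleExact`; the augmentation `aug [r] = 1` gives `aug (defect) = 1 − #(s∗t) ≤ −2`),
  the sub-calculus generated by rules (2) change of variables and (3) Newton–Leibniz alone cannot
  prove it (`not_stuffleInCovNL`: those generators are differences `[r] − [r']`, killed by `aug`;
  so every chain has net `#(s∗t) − 1` additivity moves), and multiplicities are essential
  (`not_stuffleDedup`: the deduplicated defect at `s = t = [2]` evaluates to `ζ(2,2) > 0`).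

Sources: M. Hoffman, J. Algebra 194 (1997), §2, Thm. 4.2; M. Kontsevich, D. Zagier, *Periods*
(2001), §1.2.
-/

noncomputable section

namespace Summit.KontsevichZagierPeriods.Theorems.StuffleInKZ.Negative

open MeasureTheory Set
open Literature.NumberTheory.Transcendental
open Literature.NumberTheory.Transcendental.KZ
open Literature.NumberTheory.Transcendental.MZV (IsAdmissible stuffle weight isAdmissible_nil
  isAdmissible_of_mem_stuffle stuffle_cons_cons stuffle_nil_left stuffle_nil_right sum_of_mem_stuffle)
open Summit.KontsevichZagierPeriods.KontsevichZagierPeriods.Theses.FurushoPentagon (StuffleInKZ)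

variable {n m : ℕ}

/-! ## §1 Load-bearing hypotheses -/

/-- **Pinning is load-bearing**: the crux with an ARBITRARY assignment `Z` is false — `Z ≡ [pt, 1]`
gives the value `1 − 3 = −2 ≠ 0` at `s = t = [2]`. [folklore] -/
theorem stuffleInKZ_false_without_pinning :
    ¬ ∀ Z : List ℕ → FormalRep, ∀ s t, IsAdmissible s → IsAdmissible t →
      defect Z s t ∈ relations := by
  intro h
  have hmem := h (fun _ => of IntegralRep.unit) [2] [2] (by decide) (by decide)
  have h0 : eval (defect (fun _ => of IntegralRep.unit) [2] [2]) = 0 :=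
    relations_le_ker_eval_holds hmem
  simp [defect, stuffle_cons_cons, eval_mul'] at h0

open Classical in
/-- The canonical assignment bumped by `c` at one index `u₀`. [folklore] -/
def Zbump (u₀ : List ℕ) (c : FormalRep) (u : List ℕ) : FormalRep :=
  if u = u₀ then Zcan u + c else Zcan u

/-- Bumping at a NON-admissible index keeps the assignment pinned. [folklore] -/
theorem Zbump_of_isAdmissible {u₀ : List ℕ} (hu₀ : ¬ IsAdmissible u₀) (c : FormalRep)
    (u : List ℕ) (hu : IsAdmissible u) : Zbump u₀ c u = simplexOf u hu := by
  unfold Zbump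
  rw [if_neg]
  · exact Zcan_of_isAdmissible u hu
  · rintro rfl
    exact hu₀ hu

/-- The defect at `s = [2]`, `t = [1]` of the bumped assignment: `[1,2] ∈ [2] ∗ [1]` is not
admissible, so the bump `c` enters linearly. [folklore] -/
theorem defect_Zbump_two_one (c : FormalRep) :
    defect (Zbump [1, 2] c) [2] [1] = -(Zcan [2, 1] + c + Zcan [3]) := by
  have h1 : ¬ IsAdmissible [1] := by decide
  simp [defect, Zbump, stuffle_cons_cons, Zcan_of_not h1]
  abel

/-- The defect at `s = [1]`, `t = [2]` of the bumped assignment. [folklore] -/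
theorem defect_Zbump_one_two (c : FormalRep) :
    defect (Zbump [1, 2] c) [1] [2] = -(c + Zcan [2, 1] + Zcan [3]) := by
  have h1 : ¬ IsAdmissible [1] := by decide
  simp [defect, Zbump, stuffle_cons_cons, Zcan_of_not h1]
  abel

/-- **Admissibility of `t` is load-bearing**: with it dropped the crux is false. At `s = [2]`,
`t = [1]` the stuffle term `[1,2]` is not admissible, `Z [1,2]` is unconstrained, and two pinned
assignments differing there by `[pt,1]` cannot both have their defect in `relations`. [folklore] -/
theorem stuffleInKZ_false_without_admissibleRight :
    ¬ ∀ Z : List ℕ → FormalRep, (∀ (u : List ℕ) (hu : IsAdmissible u), Z u = simplexOf u hu) →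
      ∀ s t, IsAdmissible s → defect Z s t ∈ relations := by
  intro h
  have h12 : ¬ IsAdmissible [1, 2] := by decide
  have hA := h _ (Zbump_of_isAdmissible h12 0) [2] [1] (by decide)
  have hB := h _ (Zbump_of_isAdmissible h12 (of IntegralRep.unit)) [2] [1] (by decide)
  rw [defect_Zbump_two_one] at hA hB
  apply of_unit_not_mem_relations
  have := relations.sub_mem hA hB
  convert this using 1
  abel

/-- **Admissibility of `s` is load-bearing** (mirror image, `s = [1]`, `t = [2]`). [folklore] -/
theorem stuffleInKZ_false_without_admissibleLeft :
    ¬ ∀ Z : List ℕ → FormalRep, (∀ (u : List ℕ) (hu : IsAdmissible u), Z u = simplexOf u hu) →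
      ∀ s t, IsAdmissible t → defect Z s t ∈ relations := by
  intro h
  have h12 : ¬ IsAdmissible [1, 2] := by decide
  have hA := h _ (Zbump_of_isAdmissible h12 0) [1] [2] (by decide)
  have hB := h _ (Zbump_of_isAdmissible h12 (of IntegralRep.unit)) [1] [2] (by decide)
  rw [defect_Zbump_one_two] at hA hB
  apply of_unit_not_mem_relations
  have := relations.sub_mem hA hB
  convert this using 1
  abel

/-! ## §2 Refuted natural strengthenings -/

/-- The augmentation `aug : FormalRep →+ ℤ`, `[r] ↦ 1`. [folklore] -/
def aug : FormalRep →+ ℤ := FreeAbelianGroup.lift fun _ => 1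

/-- `aug [r] = 1`. [folklore] -/
@[simp] theorem aug_of (r : IntegralRep n) : aug (of r) = 1 := FreeAbelianGroup.lift_apply_of _ _

/-- `aug ([r]·[r']) = 1` (the Fubini product of generators is a generator). [folklore] -/
theorem aug_of_mul_of (r : IntegralRep n) (r' : IntegralRep m) : aug (of r * of r') = 1 := by
  rw [of_mul_of, aug_of]

/-- **`aug (defect) = 1 − #(s ∗ t)`** for the canonical assignment. [folklore] -/
theorem aug_defect {s t : List ℕ} (hs : IsAdmissible s) (ht : IsAdmissible t) :
    aug (defect Zcan s t) = 1 - (stuffle s t).length := by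
  rw [defect, map_sub, Zcan_of_isAdmissible s hs, Zcan_of_isAdmissible t ht, simplexOf, simplexOf,
    aug_of_mul_of, map_list_sum, List.map_map]
  congr 1
  have : ∀ u ∈ stuffle s t, (aug ∘ Zcan) u = 1 := fun u hu => by
    rw [Function.comp_apply, Zcan_of_isAdmissible u (isAdmissible_of_mem_stuffle hs ht hu),
      simplexOf, aug_of]
  rw [List.map_congr_left this, List.map_const', List.sum_replicate]
  simp

/-- Hence `aug (defect) ≤ −2` for nonempty admissible indices. [folklore] -/
theorem aug_defect_le {s t : List ℕ} (hs : IsAdmissible s) (ht : IsAdmissible t) (hs' : s ≠ [])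
    (ht' : t ≠ []) : aug (defect Zcan s t) ≤ -2 := by
  rw [aug_defect hs ht]
  have := three_le_length_stuffle hs' ht'
  omega

/-- **Refuted strengthening 1**: the stuffle is not an identity of formal combinations — no
instance with `s, t` admissible and nonempty holds in the free abelian group itself. [folklore] -/
theorem not_stuffleExact {s t : List ℕ} (hs : IsAdmissible s) (ht : IsAdmissible t) (hs' : s ≠ [])
    (ht' : t ≠ []) : defect Zcan s t ≠ 0 := fun h => by
  have h0 := congrArg aug h
  have hle := aug_defect_le hs ht hs' ht'
  rw [map_zero] at h0
  omega

/-- The closure of rules (2) change of variables and (3) Newton–Leibniz alone. [folklore] -/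
def covNLRelations : AddSubgroup FormalRep :=
  AddSubgroup.closure (changeOfVariablesRel ∪ newtonLeibnizRel)

/-- The (2)+(3) closure is part of `relations`. [folklore] -/
theorem covNLRelations_le_relations : covNLRelations ≤ relations :=
  AddSubgroup.closure_mono fun _ hc => hc.elim (fun h => Or.inl (Or.inr h)) Or.inr

/-- Change-of-variables and Newton–Leibniz generators are differences `[r] − [r']`: `aug` kills
them. [folklore] -/
theorem covNLRelations_le_ker_aug : covNLRelations ≤ aug.ker := by
  refine (AddSubgroup.closure_le _).mpr ?_
  rintro c (hc | hc)
  · obtain ⟨k, r, r', -, -, -, -, -, -, -, rfl⟩ := hc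
    simp
  · obtain ⟨k, r, r', -, -, -, -, -, -, -, -, -, -, -, rfl⟩ := hc
    simp

/-- No nonempty instance of the defect lies in the (2)+(3) closure. [folklore] -/
theorem defect_not_mem_covNLRelations {s t : List ℕ} (hs : IsAdmissible s) (ht : IsAdmissible t)
    (hs' : s ≠ []) (ht' : t ≠ []) : defect Zcan s t ∉ covNLRelations := fun h => by
  have hmem := covNLRelations_le_ker_aug h
  rw [AddMonoidHom.mem_ker] at hmem
  have hle := aug_defect_le hs ht hs' ht'
  omega

/-- **Refuted strengthening 2**: the crux with `relations` replaced by the closure of rules (2) and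
(3) is false — ADDITIVITY MOVES ARE NECESSARY; indeed any chain for nonempty `(s, t)` has net
`#(s∗t) − 1 ≥ 2` additivity generators (`aug` of an additivity generator `[r] − [r₁] − [r₂]` is
`−1`). [folklore] -/
theorem not_stuffleInCovNL :
    ¬ ∀ Z : List ℕ → FormalRep, (∀ (u : List ℕ) (hu : IsAdmissible u), Z u = simplexOf u hu) →
      ∀ s t, IsAdmissible s → IsAdmissible t → defect Z s t ∈ covNLRelations := fun h =>
  defect_not_mem_covNLRelations (s := [2]) (t := [2]) (by decide) (by decide) (by simp) (by simp)
    (h Zcan Zcan_of_isAdmissible [2] [2] (by decide) (by decide))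

/-- **Refuted strengthening 3**: the stuffle WITHOUT multiplicities is false — at `s = t = [2]`
the deduplicated defect `[Δ₂]² − [Δ_{2,2}] − [Δ_4]` evaluates to `ζ(2,2) > 0`
(`multipleZeta_mul`, `multipleZeta_pos_of_isAdmissible_holds`). [folklore] -/
theorem not_stuffleDedup :
    ¬ ∀ Z : List ℕ → FormalRep, (∀ (u : List ℕ) (hu : IsAdmissible u), Z u = simplexOf u hu) →
      ∀ s t, IsAdmissible s → IsAdmissible t →
        Z s * Z t - ((stuffle s t).dedup.map Z).sum ∈ relations := fun h => by
  have h2 : IsAdmissible [2] := by decide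
  have h22 : IsAdmissible [2, 2] := by decide
  have h4 : IsAdmissible [4] := by decide
  have hmem := h Zcan Zcan_of_isAdmissible [2] [2] h2 h2
  have hd : (stuffle [2] [2]).dedup = [[2, 2], [4]] := by
    rw [show stuffle [2] [2] = [[2, 2], [2, 2], [4]] by simp [stuffle_cons_cons]]
    decide
  rw [hd] at hmem
  have h0 : eval (Zcan [2] * Zcan [2] - ([[2, 2], [4]].map Zcan).sum) = 0 :=
    relations_le_ker_eval_holds hmem
  have hv : ∀ {u : List ℕ} (hu : IsAdmissible u), eval (Zcan u) = multipleZeta u := fun hu => by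
    rw [Zcan_of_isAdmissible _ hu, simplexOf, eval_of, mzvRep_value_holds]
  simp only [map_sub, eval_mul', List.map_cons, List.map_nil, List.sum_cons, List.sum_nil, add_zero,
    map_add, hv h2, hv h22, hv h4] at h0
  have hmul := multipleZeta_mul h2 h2
  simp only [stuffle_cons_cons, stuffle_nil_left, stuffle_nil_right, List.map_cons, List.map_nil,
    List.sum_cons, List.sum_nil, List.nil_append, List.cons_append, add_zero] at hmul
  have hpos := multipleZeta_pos_of_isAdmissible_holds h22
  linarith

end Summit.KontsevichZagierPeriods.Theorems.StuffleInKZ.Negative
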